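import Summits.Ventures.GridStability.Models.StructurePreservingDissipation
import Summits.Ventures.GridStability.Lyapunov.StructurePreservingRoa

/-!
# GridStability/Models/StructurePreservingPhaseBridge — the two phase-space packagings of the
# structure-preserving model agree (reconciliation lemmas, no new mathematics)

LADDER-GRIDFUSION G3 / MODEL-VALIDITY MV-3, seat gridfusion-model-2 (g3). On 2026-08-26 two seats
typed the Bergen–Hill structure-preserving model [cite: Padiyar2013, §3.2 eq (3.2)];
[cite: BergenHill1981] as a first-order vector field on `(Fin n → ℝ) × (Fin n → ℝ)` in parallel:
the Lyapunov seat's `Summit.Ventures.GridStability.Lyapunov.StructurePreserving.phaseField`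
(frequency-shifted powers `P̄` baked in; file of record for the region-of-attraction sentence,
`Lyapunov/StructurePreservingRoa.lean`) and model-2's model-side
`StructurePreserving.Params.phaseField` (parametric in `P⁰`, used as `p.shifted.phaseField`;
`Models/StructurePreservingPhase.lean`, `…Dissipation.lean`). This file records that they are
the SAME objects — field, energy, momentum, window, constraint set, threshold level — so results
stated over either API transfer by `rw`; as the one worked instance of that transfer,
`energySublevel_subset_regionOfAttraction` re-exports the Lyapunov seat's region-of-attraction
theorem (`Lyapunov/StructurePreservingRoa.lean`, the file OF RECORD — nothing is re-proved here) in
the Models-side vocabulary (`p.shifted.phaseField`, `p.window`, `p.constraintSet`, `p.energy`).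
MODELLED column only (model MV-3); nothing here is a certificate or a statement about any grid.
-/

noncomputable section

open Real Set Filter Topology

namespace Summit.Ventures.GridStability.Models.StructurePreserving.Params

variable {n : ℕ}

/-- The Lyapunov seat's phase field is model-2's parametric phase field of the SHIFTED data
(`P⁰ ↦ P̄`): the two typings agree definitionally. -/
theorem lyapunov_phaseField_eq (p : Params n) :
    Lyapunov.StructurePreserving.phaseField p = p.shifted.phaseField := by
  funext x
  rfl

/-- The Lyapunov seat's `phaseEnergy` is model-2's printed energy read on the phase point. -/
theorem lyapunov_phaseEnergy_eq (p : Params n) (δ₀ : Fin n → ℝ) (x : (Fin n → ℝ) × (Fin n → ℝ)) :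
    Lyapunov.StructurePreserving.phaseEnergy p δ₀ x = p.energy δ₀ x.1 x.2 := rfl

/-- The Lyapunov seat's `phaseMomentum` is model-2's momentum functional, i.e. `momentumCLM`. -/
theorem lyapunov_phaseMomentum_eq (p : Params n) (x : (Fin n → ℝ) × (Fin n → ℝ)) :
    Lyapunov.StructurePreserving.phaseMomentum p x = p.momentumCLM x := by
  rw [momentumCLM_apply]
  rfl

/-- The two angle windows are the same set. -/
theorem lyapunov_window_eq (p : Params n) : Lyapunov.StructurePreserving.window p = p.window := rfl

/-- The two constraint sets (momentum level through the equilibrium ∩ frozen load-bus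
frequencies) are the same set (the conjuncts are listed in opposite order). -/
theorem lyapunov_constraintSet_eq (p : Params n) (δ₀ : Fin n → ℝ) :
    Lyapunov.StructurePreserving.constraintSet p δ₀ = p.constraintSet δ₀ := by
  ext x
  simp only [Lyapunov.StructurePreserving.constraintSet, constraintSet, mem_setOf_eq]
  exact and_comm

/-- The Lyapunov seat's threshold `levelBound θ β` is the level `g(θ)·β·(π/2 − θ)²/4` of
`branch_abs_lt_of_energy_le` / `isCompact_energySublevel`. -/
theorem lyapunov_levelBound_eq (θ β : ℝ) :
    Lyapunov.StructurePreserving.levelBound θ β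
      = (1 - Real.sin θ) / (π / 2 - θ) * β * (π / 2 - θ) ^ 2 / 4 := rfl

/-- Hence the sublevel pieces of the two assemblies coincide:
`{x ∈ window ∩ constraintSet | phaseEnergy ≤ c}` (Lyapunov seat) = model-2's `S_c`. -/
theorem lyapunov_sublevel_eq (p : Params n) (δ₀ : Fin n → ℝ) (c : ℝ) :
    {x | x ∈ Lyapunov.StructurePreserving.window p ∩ Lyapunov.StructurePreserving.constraintSet p δ₀
        ∧ Lyapunov.StructurePreserving.phaseEnergy p δ₀ x ≤ c}
      = {x | x ∈ p.window ∩ p.constraintSet δ₀ ∧ p.energy δ₀ x.1 x.2 ≤ c} := by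
  rw [lyapunov_window_eq, lyapunov_constraintSet_eq]
  rfl

/-- **Re-export through the bridge** (no new proof; the theorem OF RECORD is the Lyapunov seat's
`Lyapunov.StructurePreserving.sublevel_subset_regionOfAttraction`): Bergen–Hill's asymptotic
stability of the synchronous equilibrium of MODEL MV-3 in window form, stated over the Models-side
API — for well-formed susceptive data (`bᵢⱼ = bⱼᵢ ≥ 0`, `bᵢⱼ ≥ β > 0` on the edges of a preconnected
coupling graph, `n ≠ 0`), a synchronous equilibrium `δ₀` with `|δ₀ᵢ − δ₀ⱼ| ≤ θ < π/2` on coupled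
pairs and `c < g(θ)·β·(π/2 − θ)²/4`: from every point of
`S_c = {x ∈ p.window ∩ p.constraintSet δ₀ | V(δ₀; x) ≤ c}` a global solution of
`X' = p.shifted.phaseField X` exists, and EVERY global solution from it stays in `S_c` and tends to
`(δ₀, 0)` [cite: Padiyar2013, §3.2 Remark 2] (window form; MODELLED, MV-3; no grid sentence). -/
theorem energySublevel_subset_regionOfAttraction {p : Params n} (hp : p.WellFormed) (hn : n ≠ 0)
    (hconn : p.couplingGraph.Preconnected) (hb : ∀ i j, 0 ≤ p.b i j) {β : ℝ} (hβ : 0 < β)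
    (hβb : ∀ i j, p.couplingGraph.Adj i j → β ≤ p.b i j)
    {δ₀ : Fin n → ℝ} {θ : ℝ} (hθ0 : 0 ≤ θ) (hθ : θ < π / 2)
    (h0 : ∀ i j, p.b i j ≠ 0 → |δ₀ i - δ₀ j| ≤ θ) (hδ₀ : p.IsSyncEquilibrium δ₀)
    {c : ℝ} (hc : c < (1 - Real.sin θ) / (π / 2 - θ) * β * (π / 2 - θ) ^ 2 / 4)
    {y : (Fin n → ℝ) × (Fin n → ℝ)}
    (hy : y ∈ p.window ∩ p.constraintSet δ₀ ∧ p.energy δ₀ y.1 y.2 ≤ c) :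
    (∃ X : ℝ → (Fin n → ℝ) × (Fin n → ℝ), X 0 = y ∧
      ∀ T : ℝ, ∀ t ∈ Icc 0 T, HasDerivWithinAt X (p.shifted.phaseField (X t)) (Icc 0 T) t) ∧
    ∀ X : ℝ → (Fin n → ℝ) × (Fin n → ℝ), X 0 = y →
      (∀ T : ℝ, ∀ t ∈ Icc 0 T, HasDerivWithinAt X (p.shifted.phaseField (X t)) (Icc 0 T) t) →
      (∀ t, 0 ≤ t → X t ∈ p.window ∩ p.constraintSet δ₀ ∧ p.energy δ₀ (X t).1 (X t).2 ≤ c) ∧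
        Tendsto X atTop (𝓝 (δ₀, 0)) := by
  have hc' : c < Lyapunov.StructurePreserving.levelBound θ β := by rwa [lyapunov_levelBound_eq]
  have hy' : y ∈ Lyapunov.StructurePreserving.window p
        ∩ Lyapunov.StructurePreserving.constraintSet p δ₀
      ∧ Lyapunov.StructurePreserving.phaseEnergy p δ₀ y ≤ c := by
    rw [lyapunov_window_eq, lyapunov_constraintSet_eq]
    exact hy
  have key := Lyapunov.StructurePreserving.sublevel_subset_regionOfAttraction hp hn hconn hb hβ hβb
    hθ0 hθ h0 hδ₀ hc' hy'
  rw [lyapunov_phaseField_eq, lyapunov_window_eq, lyapunov_constraintSet_eq] at key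
  exact key

end Summit.Ventures.GridStability.Models.StructurePreserving.Params

end
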